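import Mathlib
import Summits.MatrixMultiplication.Statement
import Summits.MatrixMultiplication.MatrixMultiplication.Theses.WindowedCompletionRank

/-!
# Line `bspan` — BINARY-SPAN SEED AMPLIFICATION for the crux `WindowCompletion` (stmt-MatrixMultiplication-5495)

Strategist line (crux-strategist seat `cstrat-stmt-MatrixMultiplication-5495-h1`), lens `strengthen`.
Companion card: `Cruxes/WindowCompletion/Lines/bspan.md`; certificate: `Cruxes/WindowCompletion/SEED20.md`;
idea: `Cruxes/WindowCompletion/Ideas/binary-span-seeds.md`.

IDEA.  The first (and so far only) in-frame points with `|G|·crank < n³` that are not recursion in disguise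
are three frames at `n = 4` in `G = ℤ₂ × ℤ₁₀` with CANCELLING rank-3 completions over `ℚ(ζ₅)`
(`|G|·c = 60 < 64`; found by kit jobs j024099/j025612, made exact and verified on all `4⁶` cells by j026921 and
an independent exact verifier — `SEED20.md`).  All three frames are BINARY SPANS: `n = 2^k` (`k = 2`) and
`A x = Σ_{i : bit i of x} a_i`, `B y = Σ b_i [bit i of y]`, `C z = Σ c_i [bit i of z]` for `k`-tuples
`a b c : Fin k → G` — Minkowski sums of `k` two-point frames that MIX inside one group (a direct product of
the summands would be plain recursion and gains nothing).  The line: (1) land the seed as a theorem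
(`stub_seed20`, a finite certificate); (2) AMPLIFY it along `k` (`stub_amplify`): construct binary-span frames
for every `k` whose window-completion rank is `2^{o(k)}` in hosts of order `4^{(1+o(1))k}` — an induction on
`k` whose base is the seed and whose step is a "mixing product" rank recurrence (adding one two-point summand
inside a slightly larger group while controlling the completion rank through the cancellations the seed
exhibits); (3) forget the structure (proved inline in the skeleton; also as the named lift `liftB : LiftB`, no sorry).

WHY IT DODGES THE STUCK POINT OF LINE `vwindow`.  `vwindow` bets on OUTPUT-BLIND (bilinear, "V-form")
completions and is stalled by V-inertia (transversal-clique lower bound `∈ {n−1, n}` on > 10⁶ small frames).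
The seed completions are NOT output-blind (`u_k` depends on the output cell) and are genuinely complex
(no real rank-3 point exists numerically; the orbit is rigid of the expected dimension 15): they live exactly
in the cancelling regime that V-form, NOF-capacity and every monotone pricing exclude.

HARDEST STUB. `stub_amplify` (XL, open; the bet).  KILL: `WindowSqrtBarrier` (5493, `|G|·c² ≥ n³`, which
gives `¬ WindowCompletion` via `BarrierKillsWindow`) refutes `BinarySpanCompletion` a fortiori; a cheaper,
line-specific kill is a MIXING NO-GO: "for binary-span frames `|G|·c ≥ n^{3−o(1)}`" or even "`c ≥ 2^{k−1}+1`
for all binary-span frames with `|G| ≤ 4^k · poly(k)`" (census target for j026927: `k = 3`).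
BARRIERS.  Group-theoretic barrier theorems (BCCGNSU17 / slice rank, Literature.Barriers.MatrixMultiplication)
bound STPP/simultaneous-embedding constructions, i.e. SUPPORT-MONOTONE completions of the host group tensor;
the seed is a cancelling completion of a WINDOW (a coset-free partial tensor), outside that class — the
barrier that does apply is the route's own conjectural `WindowSqrtBarrier`, not a theorem.
DISPROOF USED.  No `Disproof.lean` is registered for this crux (none in the payload); the negatives index of
the summit has no statement about window completions.  DEAD LINES AVOIDED.  Full-window strengthening
(`|G| = n²`: no factorisation triples at 16/25, rank plateau), seed+amplification with `Sub₁ := ¬5493`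
(no mechanism — costume), mass/correlation and NOF-capacity transfers (price only monotone completions).
-/

namespace Summit.MatrixMultiplication.MatrixMultiplication.Cruxes.WindowCompletion.Bspan

open scoped BigOperators
open Literature.Computability.AlgebraicComplexity
open Summit.MatrixMultiplication.MatrixMultiplication.Theses.WindowedCompletionRank

/-- THE SEED (n = 4, |G| = 20, rank 3; TRUE — exact certificate over `ℚ(ζ₅)` in `SEED20.md`, frames
F1 `A=(0,1,5,6) B=(0,2,10,12) C=(0,3,14,17)`, F2 `B=(0,2,11,13) C=(0,3,15,18)`, F3 `A=(0,1,2,3) B=(0,4,10,14)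
C=(0,5,12,17)` in `ℤ₂ × ℤ₁₀ ≅ ZMod 2 × ZMod 10`, element `10e+t ↦ (e,t)`).  `|G|·c = 60 < 64 = n³`. -/
def WindowSeedTwenty : Prop :=
  ∃ (A B C : Fin 4 → ZMod 2 × ZMod 10) (S : ZMod 2 × ZMod 10 → ZMod 2 × ZMod 10 → ZMod 2 × ZMod 10 → ℂ),
    tensorRank S ≤ 3 ∧
    (matMulTensor ℂ 4 4 4 = fun a b c =>
        if (A b.1 - B b.2) + (B c.1 + C c.2) = A a.1 + C a.2
        then S (A a.1 + C a.2) (A b.1 - B b.2) (B c.1 + C c.2) else 0)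

/-- Binary-span legs: `n = 2^k` via `e : Fin n ≃ (Fin k → Bool)` and each leg is the `{0,1}`-span of a
`k`-tuple of group elements. -/
def IsBinarySpan {G : Type} [AddCommGroup G] {n : ℕ} (A B C : Fin n → G) : Prop :=
  ∃ (k : ℕ) (e : Fin n ≃ (Fin k → Bool)) (a b c : Fin k → G),
    (∀ x, A x = ∑ i, if e x i then a i else 0) ∧ (∀ y, B y = ∑ i, if e y i then b i else 0) ∧
    (∀ z, C z = ∑ i, if e z i then c i else 0)

/-- BINARY-SPAN COMPLETION = the crux `WindowCompletion` restricted to binary-span frames (a strict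
strengthening; lens `strengthen`).  WHY EASIER: the family is indexed by `k`-tuples of generators, so
existence can be argued by INDUCTION ON `k` (a rank recurrence for adding one two-point summand), which the
unstructured crux does not offer; and it is killable by a no-go specific to binary spans. -/
def BinarySpanCompletion : Prop :=
  ∀ ε : ℝ, 0 < ε → ∃ n : ℕ, 2 ≤ n ∧ ∃ (G : Type) (_ : AddCommGroup G) (_ : Fintype G) (_ : DecidableEq G),
    (Fintype.card G : ℝ) ≤ (n : ℝ) ^ (2 + ε) ∧
    ∃ (A B C : Fin n → G) (S : G → G → G → ℂ),
      IsBinarySpan A B C ∧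
      (tensorRank S : ℝ) ≤ (n : ℝ) ^ ε ∧
      (matMulTensor ℂ n n n = fun a b c =>
          if (A b.1 - B b.2) + (B c.1 + C c.2) = A a.1 + C a.2
          then S (A a.1 + C a.2) (A b.1 - B b.2) (B c.1 + C c.2) else 0)

/-- SEED AMPLIFICATION — the statement of the hard stub: from the `k = 2` base case, binary-span window
completions of rank `n^ε` in hosts of order `n^(2+ε)` for every `ε > 0` (induction on `k`; the step is the
conjectural mixing-product rank recurrence).  Named so that no stub's type is literally the crux. -/
def SeedAmplification : Prop := WindowSeedTwenty → BinarySpanCompletion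

/-- STUB 1 (M, PROVABLE NOW): the seed.  Proof route: `θ := Complex.exp (2πi/5)` (only
`1 + θ + θ² + θ³ + θ⁴ = 0` is needed), tables `U_k V_k W_k : ZMod 2 × ZMod 10 → ℂ` from `SEED20.md` (F1,
coefficient height ≤ 6 in `(1/5)ℤ[θ]`), `S g u v := ∑ k : Fin 3, U k g * V k u * W k v`, rank by
`tensorRank_le_of_eq_sum`, and the `4⁶`-cell function equality by `funext` + `fin_cases` + `decide` on the
`ZMod 2 × ZMod 10` condition + `ring_nf`/`linear_combination` modulo the cyclotomic relation. -/
theorem stub_seed20 : WindowSeedTwenty := by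
  sorry

/-- STUB 2 (XL, OPEN — the bet of the line): amplification of the seed along `k` (see
`SeedAmplification`).  Why it might fail: `WindowSqrtBarrier` (5493) refutes the conclusion outright; more
cheaply, a binary-span mixing no-go at `k = 3` (`n = 8`: no rank ≤ 7 with `|G|·c < 512`, kit census j026927)
would leave the seed isolated. -/
theorem stub_amplify : SeedAmplification := by
  sorry

/-- SKELETON (kernel-checked, no `sorry` of its own, no hypotheses): the crux `WindowCompletion` BY NAME
from the two registered stubs — `sorry` enters only through `stub_seed20` and `stub_amplify`; the seam
(forgetting the binary-span structure) is proved inline.  This is the first theorem of the file whose type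
concludes the crux (the one `ledger skeleton check` audits) — and the only one: the named lift `liftB : LiftB`
and the hypothesis form (an `example`) below do not literally conclude the crux. -/
theorem WindowCompletion_skeleton : WindowCompletion := by
  intro ε hε
  obtain ⟨n, hn, G, i1, i2, i3, hG, A, B, C, S, _, hS, hW⟩ :=
    (show WindowSeedTwenty → BinarySpanCompletion from stub_amplify) stub_seed20 ε hε
  exact ⟨n, hn, G, i1, i2, i3, hG, A, B, C, S, hS, hW⟩

/-- `LiftB` — the lift statement `BinarySpanCompletion → WindowCompletion` (proved below, no sorry). -/
def LiftB : Prop := BinarySpanCompletion → WindowCompletion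

/-- LIFT (PROVED): a binary-span completion is a window completion — forget the structure. -/
theorem liftB : LiftB := by
  intro h ε hε
  obtain ⟨n, hn, G, i1, i2, i3, hG, A, B, C, S, _, hS, hW⟩ := h ε hε
  exact ⟨n, hn, G, i1, i2, i3, hG, A, B, C, S, hS, hW⟩

/-- COMPOSITION in hypothesis form (`WindowCompletion_of`; kernel-checked at elaboration, sorry-free): the two
stub STATEMENTS imply the crux by name; the seam is the proved lift `liftB` plus modus ponens.  Stated as an
`example` on purpose: the skeleton audit picks its candidate among ALL theorems whose type concludes the crux in
environment (hash) order, so the file keeps exactly one such theorem, `WindowCompletion_skeleton`. -/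
example : WindowSeedTwenty → SeedAmplification → WindowCompletion :=
  fun hSeed hAmp => (show BinarySpanCompletion → WindowCompletion from liftB)
    ((show WindowSeedTwenty → BinarySpanCompletion from hAmp) hSeed)

/-! ## Sanity (sorry-free, informational, `example`s only — no orphan declarations): the seed frame F1
(`A = (0,1,5,6)`, `B = (0,2,10,12)`, `C = (0,3,14,17)` in `ℤ₂ × ℤ₁₀`, `10e+t ↦ (e,t)`) has injective legs on
`[4]²` (`γ(x,z) = A x + C z`, `α(x,y) = A x − B y`, `β(y,z) = B y + C z` take 16 distinct values each). -/

example : Function.Injective (fun p : Fin 4 × Fin 4 =>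
    (![(0,0), (0,1), (0,5), (0,6)] : Fin 4 → ZMod 2 × ZMod 10) p.1 +
    (![(0,0), (0,3), (1,4), (1,7)] : Fin 4 → ZMod 2 × ZMod 10) p.2) := by decide   -- γ = A x + C z
example : Function.Injective (fun p : Fin 4 × Fin 4 =>
    (![(0,0), (0,1), (0,5), (0,6)] : Fin 4 → ZMod 2 × ZMod 10) p.1 -
    (![(0,0), (0,2), (1,0), (1,2)] : Fin 4 → ZMod 2 × ZMod 10) p.2) := by decide   -- α = A x − B y
example : Function.Injective (fun p : Fin 4 × Fin 4 =>
    (![(0,0), (0,2), (1,0), (1,2)] : Fin 4 → ZMod 2 × ZMod 10) p.1 +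
    (![(0,0), (0,3), (1,4), (1,7)] : Fin 4 → ZMod 2 × ZMod 10) p.2) := by decide   -- β = B y + C z

end Summit.MatrixMultiplication.MatrixMultiplication.Cruxes.WindowCompletion.Bspan
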